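import Summits.HodgeConjecture.HodgeConjecture.Theorems.F0P3cStCharTSPSLevelsCells      -- (C3a) (this seat): the line on the cells, the witness; brings ★ (G6)-ST FILE D∕C∕A (F0P3a-p06)
import HarnessLib

/-!
# «PS-LEVELS»: the parahoric levels of a principal series `i_G(χ₁, χ₂)` of `G_v = U(Φ₃)(L⁺_v)` are `(c, c, 2c)`, `c = [χ ≡ 1 on T ∩ K_v]`
# (E1 ROW 35 «EP-CROSS (i) @ DATUM», input (C3b); Borel 1976 §3–§4, Casselman 1995 §3 ∕ Prop. 1.3.1, Rogawski 1990 §12.2)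

Cell `pub/hodgecm-mathlib`, crux H413 = `stmt-HodgeConjecture-24833`, LH6 leaf, organ (S-𝔑) `stub_EllipticInputs`, consequent 3 (`h61bRest`); E1 row 35 (keeper
F0P3a-p03 (g29); seat LH6-p03 (g9)).  THEOREMS ONLY (`--supports`, `--as helper`); no `def`, no instance, no notation, no `sorry`.  The general-pair twins of ★ (G6)-ST
FILE A §3 ∕ FILE D §2–§3 (there `χ = χ_St(ψ₀)`; here ANY pair `(χ₁, χ₂)`), in the letters of ★ (G3)-EXPLICIT (`w hw eA heA hd g₁ hg₁ K0 K1 I hK0 hK1 hI`).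

WHAT.  Write `U(χ) :≡ ∀ t ∈ T, t ∈ K_v → χ t = 1` («`χ` unramified»: `χ₁` trivial on `𝒪_v^×` and `χ₂ = 1`).  Then for `V = i_G(χ)` (★ `cmPrincipalSeries L 3 v χ`):
`dim V^{K0} = [U]`, `dim V^{K1} = [U]`, `dim V^{I} = 2·[U]` — the levels input `(1,1,2)` ∕ `(0,0,0)` of ★ E1-28 `IrrClass.ep_eq_zero_of_constituents_pair`.
* §1–§2 (the line on the cells under `U`; the witness under `¬U`) are the prequel file `F0P3cStCharTSPSLevelsCells` (this seat).
* §3 (here) the three counts (★ `isSpherical_cmPrincipalSeries` ∕ ★ one-coset Mackey at `K_v`; ★ MACKEY `finrank_fixedPoints_smoothIndRep_eq_card_filter` over FILE C's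
  `cover_borel_K1` and `cover_borel_I` ∕ `disj_borel_I`).

HONEST LABEL: count-neutral helper (row 35 input); h413 OPEN; HC_CM is proved only modulo the 7 printed citations (2 remaining: hLiu418 =
stmt-HodgeConjecture-24832, h413 = stmt-HodgeConjecture-24833) until rung 0 closes.
## References
* [Borel1976] A. Borel, *Admissible representations of a semi-simple group over a local field with vectors fixed under an Iwahori subgroup*, Invent. Math. 35 (1976), §3–§4.
* [Casselman1995] W. Casselman, *Introduction to the theory of admissible representations of p-adic reductive groups* (1995), Prop. 1.3.1, §3.
* [Rogawski1990] J. D. Rogawski, *Automorphic Representations of Unitary Groups in Three Variables*, Ann. of Math. Stud. 123 (1990), §4.5 p. 45, §12.1 p. 171, §12.2 pp. 173–174.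
* [BruhatTits1972] F. Bruhat, J. Tits, *Groupes réductifs sur un corps local I*, Publ. Math. IHÉS 41 (1972), (4.4.3)–(4.4.4).
* [CartierCorvallis1979] P. Cartier, *Representations of p-adic groups: a survey*, PSPM 33.1 (1979), §III.3, §IV.1.
-/

set_option autoImplicit false
-- the mandated namespace has the single-problem summit's repeated segment (`HodgeConjecture.HodgeConjecture`)
set_option linter.dupNamespace false

noncomputable section

open NumberField IsDedekindDomain MeasureTheory
open scoped Matrix MatrixGroups NNReal WithZero
open Literature.NumberTheory.Automorphic Literature.NumberTheory.Automorphic.UnitaryGroup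
open Literature.NumberTheory.Rogawski1990 Literature.NumberTheory.GaloisRepresentations

namespace Summit.HodgeConjecture.HodgeConjecture.Cruxes.H413.F0P3cStCharTSPSLevels

open Summit.HodgeConjecture.HodgeConjecture.Cruxes.H413
open Summit.HodgeConjecture.HodgeConjecture.Cruxes.H413.F0P3cStCharTSStLevelsTransport
open Summit.HodgeConjecture.HodgeConjecture.Cruxes.H413.F0P3cStCharTSStIwahoriFixed
open Summit.HodgeConjecture.HodgeConjecture.Cruxes.H413.F0P3cStCharTSPSLevelsCells

variable (L : Type) [Field L] [NumberField L] [IsCMField L] (v : HeightOneSpectrum (𝓞 ↥(maximalRealSubfield L)))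
  (w : PlacesOver L v) (hw : IsCMField.complexConj L • w.1 = w.1)
  (eA : Gqs L v ≃ₜ* ↥(unitaryGroupOfForm (galAdicCompletionMap (L := L) (IsCMField.complexConj L) hw) ((StdForm.antidiagonal 3).over (w.1.adicCompletion L))))
  (heA : ∀ g : Gqs L v,
    ((eA g : ↥(unitaryGroupOfForm (galAdicCompletionMap (L := L) (IsCMField.complexConj L) hw) ((StdForm.antidiagonal 3).over (w.1.adicCompletion L)))) : GL (Fin 3) (w.1.adicCompletion L)) =
      ((localNonsplitEquiv (IsCMField.complexConj L) (qsForm L) (IsCMField.complexConj_ne_one L) w hw g :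
        ↥(unitaryGroupOfForm (galAdicCompletionMap (L := L) (IsCMField.complexConj L) hw) (placeForm (qsForm L) w.1))) : GL (Fin 3) (w.1.adicCompletion L)))

/-! ## §3 The three counts -/

set_option maxHeartbeats 1600000 in
set_option synthInstance.maxHeartbeats 400000 in
-- instance-path unification between `Gqs L v` and the literal carrier of ★ `cmPrincipalSeries`
/-- **A witness kills the `B ∩ K`-fixed line**: if `t ∈ T ∩ K_v` with `χ t ≠ 1` lies in `K`, the inducing line has no non-zero `(K ∩ B)`-fixed vector.
[cite: Rogawski1990, §4.5 p. 45; §12.1 p. 171] [cite: CartierCorvallis1979, §III.3] -/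
theorem lineFixedPoints_eq_bot_of_witness (χ : ↥(torusU (conjLocal L (IsCMField.complexConj L) v) (cmLocalForm L 3 v)) →* ℂˣ)
    {K : Subgroup ↥(unitaryGroupOfForm (conjLocal L (IsCMField.complexConj L) v) (cmLocalForm L 3 v))} {t : ↥(torusU (conjLocal L (IsCMField.complexConj L) v) (cmLocalForm L 3 v))}
    (ht : (t : ↥(unitaryGroupOfForm (conjLocal L (IsCMField.complexConj L) v) (cmLocalForm L 3 v))) ∈ cmLocalIntegralLevel L 3 (qsForm L) v) (htK : (t : ↥(unitaryGroupOfForm (conjLocal L (IsCMField.complexConj L) v) (cmLocalForm L 3 v))) ∈ K) (hχt : χ t ≠ 1) :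
    haveI := locallyCompactSpace_cmBorelU L 3 v
    (Representation.twist
      (((Representation.trivial ℂ ↥(torusU (conjLocal L (IsCMField.complexConj L) v) (cmLocalForm L 3 v)) ℂ).twist χ).comp (cmBorelTriple L 3 v).proj)
      (rootDeltaChar (cmBorelTriple L 3 v).P)).fixedPoints (K.subgroupOf (cmBorelTriple L 3 v).P) = ⊥ := by
  haveI := locallyCompactSpace_cmBorelU L 3 v
  refine (Submodule.eq_bot_iff _).2 fun z hz => ?_
  have htB : ((t : ↥(unitaryGroupOfForm (conjLocal L (IsCMField.complexConj L) v) (cmLocalForm L 3 v))) ∈ (cmBorelTriple L 3 v).P) := torusU_le_borelU _ _ t.2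
  have hp : (⟨_, htB⟩ : ↥(cmBorelTriple L 3 v).P) ∈ K.subgroupOf (cmBorelTriple L 3 v).P := Subgroup.mem_subgroupOf.2 htK
  have hfix := (Representation.mem_fixedPoints _ _ z).1 hz _ hp
  rw [inducingLine_apply_torus L v χ t ht, LinearMap.smul_apply, Module.End.one_apply, smul_eq_mul] at hfix
  have hne : ((χ t : ℂˣ) : ℂ) ≠ 1 := fun h => hχt (Units.val_eq_one.1 h)
  have : (((χ t : ℂˣ) : ℂ) - 1) * z = 0 := by rw [sub_mul, one_mul, hfix, sub_self]
  rcases mul_eq_zero.1 this with h0 | h0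
  · exact absurd (sub_eq_zero.1 h0) hne
  · exact h0

include heA in
open Classical in
set_option maxHeartbeats 1600000 in
set_option synthInstance.maxHeartbeats 400000 in
-- instance-path unification between `Gqs L v` and the literal carrier of ★ `cmPrincipalSeries`
/-- **`dim i_G(χ)^{K0} = [U]`**: `K0 = K_v` (FILE C); if `χ ≡ 1` on `T ∩ K_v` the spherical LINE (★ `isSpherical_cmPrincipalSeries`); else the witness `t ∈ T ∩ K_v`, `χ t ≠ 1`,
kills the `B ∩ K_v`-fixed line and Iwasawa `G_v = B·K_v` (★ one-coset Mackey `finrank_fixedPoints_smoothIndRep_eq`) gives `0`.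
[cite: Rogawski1990, §4.5 p. 45; §12.2 p. 173] [cite: CartierCorvallis1979, §III.3, §IV.1] [cite: Casselman1995, §3] -/
theorem finrank_fixedPoints_cmPrincipalSeries_K0
    (K0 : Subgroup (Gqs L v))
    (hK0 : K0 = ((glInt 3 (w.1.adicCompletion L)).subgroupOf
      (unitaryGroupOfForm (galAdicCompletionMap (L := L) (IsCMField.complexConj L) hw) ((StdForm.antidiagonal 3).over (w.1.adicCompletion L)))).comap
        eA.toMulEquiv.toMonoidHom)
    (χ : ↥(torusU (conjLocal L (IsCMField.complexConj L) v) (cmLocalForm L 3 v)) →* ℂˣ) :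
    Module.finrank ℂ ((cmPrincipalSeries L 3 v χ).fixedPoints K0) = if (∀ t : ↥(torusU (conjLocal L (IsCMField.complexConj L) v) (cmLocalForm L 3 v)), (t : ↥(unitaryGroupOfForm (conjLocal L (IsCMField.complexConj L) v) (cmLocalForm L 3 v))) ∈ cmLocalIntegralLevel L 3 (qsForm L) v → χ t = 1) then 1 else 0 := by
  haveI := locallyCompactSpace_cmBorelU L 3 v
  have hK0' : K0 = cmLocalIntegralLevel L 3 (qsForm L) v := Subgroup.ext fun g => mem_K0_iff_mem_integralLevel L v w hw eA heA K0 hK0 g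
  rw [hK0']
  by_cases hU : (∀ t : ↥(torusU (conjLocal L (IsCMField.complexConj L) v) (cmLocalForm L 3 v)), (t : ↥(unitaryGroupOfForm (conjLocal L (IsCMField.complexConj L) v) (cmLocalForm L 3 v))) ∈ cmLocalIntegralLevel L 3 (qsForm L) v → χ t = 1)
  · rw [if_pos hU]
    exact isSpherical_cmPrincipalSeries L 3 v χ hU
  · rw [if_neg hU]
    push Not at hU
    obtain ⟨t, ht, hχt⟩ := hU
    have hK := isCompact_isOpen_cmLocalIntegralLevel L 3 (qsForm L) v
    have hbot := lineFixedPoints_eq_bot_of_witness L v χ (K := cmLocalIntegralLevel L 3 (qsForm L) v) ht ht hχt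
    have hGK : ∀ g : ↥(unitaryGroupOfForm (conjLocal L (IsCMField.complexConj L) v) (cmLocalForm L 3 v)), ∃ h : ↥(cmBorelTriple L 3 v).P, ∃ κ : ↥(unitaryGroupOfForm (conjLocal L (IsCMField.complexConj L) v) (cmLocalForm L 3 v)), κ ∈ cmLocalIntegralLevel L 3 (qsForm L) v ∧ g = (h : ↥(unitaryGroupOfForm (conjLocal L (IsCMField.complexConj L) v) (cmLocalForm L 3 v))) * κ := fun g => by
      obtain ⟨h, κ, hκ, hg⟩ := exists_borel_mul_mem_cmLocalIntegralLevel L 3 v g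
      exact ⟨h, κ, hκ, hg⟩
    have hM := Representation.finrank_fixedPoints_smoothIndRep_eq (Representation.twist
      (((Representation.trivial ℂ ↥(torusU (conjLocal L (IsCMField.complexConj L) v) (cmLocalForm L 3 v)) ℂ).twist χ).comp (cmBorelTriple L 3 v).proj)
      (rootDeltaChar (cmBorelTriple L 3 v).P)) hK.2 hGK
    have hB := (congrArg (fun S : Submodule ℂ ℂ => Module.finrank ℂ ↥S) hbot).trans (finrank_bot ℂ ℂ)
    exact hM.trans hB

include heA in
open Classical in
set_option maxHeartbeats 1600000 in
set_option synthInstance.maxHeartbeats 400000 in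
-- instance-path unification between `Gqs L v` and the literal carrier of ★ `cmPrincipalSeries`
/-- **`dim i_G(χ)^{I} = 2·[U]`** (MACKEY ★ `finrank_fixedPoints_smoothIndRep_eq_card_filter` over `G_v = B·I ⊔ B·w̃·I`, FILE C): under `U` both cells are alive (their `B ∩ gIg⁻¹`
lie in `K0 = K_v`, §1); under `¬U` the witness `t` lies in `I` and `w̃⁻¹ t w̃ ∈ I` (§2) and kills both.  The general form of FILE D `finrank_fixedPoints_cmPrincipalSeries_stChar_I`.
[cite: Borel1976, §3–§4] [cite: Casselman1995, Prop. 1.3.1, §3] [cite: BruhatTits1972, (4.4.4)] -/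
theorem finrank_fixedPoints_cmPrincipalSeries_I {ϖ : w.1.adicCompletion L}
    (hd : HermitianLattice.UnramifiedLocalConjDatum (galAdicCompletionMap (L := L) (IsCMField.complexConj L) hw) ϖ)
    (g₁ : GL (Fin 3) (w.1.adicCompletion L)) (hg₁ : (g₁ : Matrix (Fin 3) (Fin 3) (w.1.adicCompletion L)) = Matrix.diagonal ![(1 : w.1.adicCompletion L), 1, ϖ])
    (K0 K1 I : Subgroup (Gqs L v))
    (hK0 : K0 = ((glInt 3 (w.1.adicCompletion L)).subgroupOf
      (unitaryGroupOfForm (galAdicCompletionMap (L := L) (IsCMField.complexConj L) hw) ((StdForm.antidiagonal 3).over (w.1.adicCompletion L)))).comap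
        eA.toMulEquiv.toMonoidHom)
    (hK1 : K1 = (((glInt 3 (w.1.adicCompletion L)).map (MulAut.conj g₁).toMonoidHom).subgroupOf
      (unitaryGroupOfForm (galAdicCompletionMap (L := L) (IsCMField.complexConj L) hw) ((StdForm.antidiagonal 3).over (w.1.adicCompletion L)))).comap
        eA.toMulEquiv.toMonoidHom)
    (hI : I = K0 ⊓ K1)
    (χ : ↥(torusU (conjLocal L (IsCMField.complexConj L) v) (cmLocalForm L 3 v)) →* ℂˣ) :
    Module.finrank ℂ ((cmPrincipalSeries L 3 v χ).fixedPoints I) = if (∀ t : ↥(torusU (conjLocal L (IsCMField.complexConj L) v) (cmLocalForm L 3 v)), (t : ↥(unitaryGroupOfForm (conjLocal L (IsCMField.complexConj L) v) (cmLocalForm L 3 v))) ∈ cmLocalIntegralLevel L 3 (qsForm L) v → χ t = 1) then 2 else 0 := by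
  haveI := locallyCompactSpace_cmBorelU L 3 v
  have hIo' := (isOpen_isCompact_levels L v w hw eA g₁ K0 K1 I hK0 hK1 hI).2.2.1
  have hIo : @IsOpen ↥(unitaryGroupOfForm (conjLocal L (IsCMField.complexConj L) v) (cmLocalForm L 3 v)) inferInstance (I : Set (Gqs L v)) := hIo'
  have hM := Representation.finrank_fixedPoints_smoothIndRep_eq_card_filter (Representation.twist
      (((Representation.trivial ℂ ↥(torusU (conjLocal L (IsCMField.complexConj L) v) (cmLocalForm L 3 v)) ℂ).twist χ).comp (cmBorelTriple L 3 v).proj)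
      (rootDeltaChar (cmBorelTriple L 3 v).P)) hIo
    (cover_borel_I L v w hw eA heA hd g₁ hg₁ K0 K1 I hK0 hK1 hI) (disj_borel_I L v w hw eA heA hd g₁ hg₁ K0 K1 I hK0 hK1 hI) (Module.finrank_self ℂ)
  refine hM.trans ?_
  have mulK0 : ∀ x y : ↥(unitaryGroupOfForm (conjLocal L (IsCMField.complexConj L) v) (cmLocalForm L 3 v)), x ∈ K0 → y ∈ K0 → x * y ∈ K0 := fun x y hx hy => K0.mul_mem hx hy
  have invK0 : ∀ x : ↥(unitaryGroupOfForm (conjLocal L (IsCMField.complexConj L) v) (cmLocalForm L 3 v)), x ∈ K0 → x⁻¹ ∈ K0 := fun x hx => K0.inv_mem hx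
  have hw0 : (![(1 : ↥(unitaryGroupOfForm (conjLocal L (IsCMField.complexConj L) v) (cmLocalForm L 3 v))), eA.symm (weylLongU (galAdicCompletionMap (L := L) (IsCMField.complexConj L) hw) (rfl : (StdForm.antidiagonal 3).over (w.1.adicCompletion L) = _))] 1) ∈ K0 := eA_symm_weylLongU_mem_K0 L v w hw eA K0 hK0
  have hIK0 : ∀ x : ↥(unitaryGroupOfForm (conjLocal L (IsCMField.complexConj L) v) (cmLocalForm L 3 v)), x ∈ I → x ∈ K0 := fun x hx => I_le_K0 L v K0 K1 I hI hx
  by_cases hU : (∀ t : ↥(torusU (conjLocal L (IsCMField.complexConj L) v) (cmLocalForm L 3 v)), (t : ↥(unitaryGroupOfForm (conjLocal L (IsCMField.complexConj L) v) (cmLocalForm L 3 v))) ∈ cmLocalIntegralLevel L 3 (qsForm L) v → χ t = 1)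
  · rw [if_pos hU, Finset.filter_true_of_mem, Finset.card_univ, Fintype.card_fin]
    intro i _ h hmem
    have hmem' : (![(1 : ↥(unitaryGroupOfForm (conjLocal L (IsCMField.complexConj L) v) (cmLocalForm L 3 v))), eA.symm (weylLongU (galAdicCompletionMap (L := L) (IsCMField.complexConj L) hw) (rfl : (StdForm.antidiagonal 3).over (w.1.adicCompletion L) = _))] i)⁻¹ * (h : ↥(unitaryGroupOfForm (conjLocal L (IsCMField.complexConj L) v) (cmLocalForm L 3 v))) * (![(1 : ↥(unitaryGroupOfForm (conjLocal L (IsCMField.complexConj L) v) (cmLocalForm L 3 v))), eA.symm (weylLongU (galAdicCompletionMap (L := L) (IsCMField.complexConj L) hw) (rfl : (StdForm.antidiagonal 3).over (w.1.adicCompletion L) = _))] i) ∈ I := hmem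
    have hhK0 : (h : ↥(unitaryGroupOfForm (conjLocal L (IsCMField.complexConj L) v) (cmLocalForm L 3 v))) ∈ K0 := by
      fin_cases i
      · have heq : (![(1 : ↥(unitaryGroupOfForm (conjLocal L (IsCMField.complexConj L) v) (cmLocalForm L 3 v))), eA.symm (weylLongU (galAdicCompletionMap (L := L) (IsCMField.complexConj L) hw) (rfl : (StdForm.antidiagonal 3).over (w.1.adicCompletion L) = _))] (0 : Fin 2))⁻¹ * (h : ↥(unitaryGroupOfForm (conjLocal L (IsCMField.complexConj L) v) (cmLocalForm L 3 v))) * (![(1 : ↥(unitaryGroupOfForm (conjLocal L (IsCMField.complexConj L) v) (cmLocalForm L 3 v))), eA.symm (weylLongU (galAdicCompletionMap (L := L) (IsCMField.complexConj L) hw) (rfl : (StdForm.antidiagonal 3).over (w.1.adicCompletion L) = _))] (0 : Fin 2)) = h := by simp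
        have h' : (![(1 : ↥(unitaryGroupOfForm (conjLocal L (IsCMField.complexConj L) v) (cmLocalForm L 3 v))), eA.symm (weylLongU (galAdicCompletionMap (L := L) (IsCMField.complexConj L) hw) (rfl : (StdForm.antidiagonal 3).over (w.1.adicCompletion L) = _))] (0 : Fin 2))⁻¹ * (h : ↥(unitaryGroupOfForm (conjLocal L (IsCMField.complexConj L) v) (cmLocalForm L 3 v))) * (![(1 : ↥(unitaryGroupOfForm (conjLocal L (IsCMField.complexConj L) v) (cmLocalForm L 3 v))), eA.symm (weylLongU (galAdicCompletionMap (L := L) (IsCMField.complexConj L) hw) (rfl : (StdForm.antidiagonal 3).over (w.1.adicCompletion L) = _))] (0 : Fin 2)) ∈ I := hmem'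
        rw [heq] at h'
        exact hIK0 _ h'
      · have h' : (![(1 : ↥(unitaryGroupOfForm (conjLocal L (IsCMField.complexConj L) v) (cmLocalForm L 3 v))), eA.symm (weylLongU (galAdicCompletionMap (L := L) (IsCMField.complexConj L) hw) (rfl : (StdForm.antidiagonal 3).over (w.1.adicCompletion L) = _))] (1 : Fin 2))⁻¹ * (h : ↥(unitaryGroupOfForm (conjLocal L (IsCMField.complexConj L) v) (cmLocalForm L 3 v))) * (![(1 : ↥(unitaryGroupOfForm (conjLocal L (IsCMField.complexConj L) v) (cmLocalForm L 3 v))), eA.symm (weylLongU (galAdicCompletionMap (L := L) (IsCMField.complexConj L) hw) (rfl : (StdForm.antidiagonal 3).over (w.1.adicCompletion L) = _))] (1 : Fin 2)) ∈ I := hmem'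
        have hprod := mulK0 _ _ (mulK0 _ _ hw0 (hIK0 _ h')) (invK0 _ hw0)
        have heq : (![(1 : ↥(unitaryGroupOfForm (conjLocal L (IsCMField.complexConj L) v) (cmLocalForm L 3 v))), eA.symm (weylLongU (galAdicCompletionMap (L := L) (IsCMField.complexConj L) hw) (rfl : (StdForm.antidiagonal 3).over (w.1.adicCompletion L) = _))] (1 : Fin 2)) * ((![(1 : ↥(unitaryGroupOfForm (conjLocal L (IsCMField.complexConj L) v) (cmLocalForm L 3 v))), eA.symm (weylLongU (galAdicCompletionMap (L := L) (IsCMField.complexConj L) hw) (rfl : (StdForm.antidiagonal 3).over (w.1.adicCompletion L) = _))] (1 : Fin 2))⁻¹ * (h : ↥(unitaryGroupOfForm (conjLocal L (IsCMField.complexConj L) v) (cmLocalForm L 3 v))) * (![(1 : ↥(unitaryGroupOfForm (conjLocal L (IsCMField.complexConj L) v) (cmLocalForm L 3 v))), eA.symm (weylLongU (galAdicCompletionMap (L := L) (IsCMField.complexConj L) hw) (rfl : (StdForm.antidiagonal 3).over (w.1.adicCompletion L) = _))] (1 : Fin 2))) * (![(1 : ↥(unitaryGroupOfForm (conjLocal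 L (IsCMField.complexConj L) v) (cmLocalForm L 3 v))), eA.symm (weylLongU (galAdicCompletionMap (L := L) (IsCMField.complexConj L) hw) (rfl : (StdForm.antidiagonal 3).over (w.1.adicCompletion L) = _))] (1 : Fin 2))⁻¹ = h := by group
        rw [heq] at hprod
        exact hprod
    exact inducingLine_eq_one_of_mem_integralLevel L v χ hU h ((mem_K0_iff_mem_integralLevel L v w hw eA heA K0 hK0 _).1 hhK0)
  · rw [if_neg hU, Finset.card_eq_zero, Finset.filter_eq_empty_iff]
    push Not at hU
    obtain ⟨t, ht, hχt⟩ := hU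
    obtain ⟨-, hcells⟩ := torus_mem_cells L v w hw eA heA hd g₁ hg₁ K0 K1 I hK0 hK1 hI t ht
    intro i _ hall
    have htB : ((t : ↥(unitaryGroupOfForm (conjLocal L (IsCMField.complexConj L) v) (cmLocalForm L 3 v))) ∈ (cmBorelTriple L 3 v).P) := torusU_le_borelU _ _ t.2
    have h1p := hall ⟨_, htB⟩ (hcells i)
    rw [inducingLine_apply_torus L v χ t ht] at h1p
    have h11 := LinearMap.congr_fun h1p (1 : ℂ)
    rw [LinearMap.smul_apply, Module.End.one_apply, smul_eq_mul, mul_one] at h11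
    exact hχt (Units.val_eq_one.1 h11)

include heA in
open Classical in
set_option maxHeartbeats 1600000 in
set_option synthInstance.maxHeartbeats 400000 in
-- instance-path unification between `Gqs L v` and the literal carrier of ★ `cmPrincipalSeries`
/-- **`dim i_G(χ)^{K1} = [U]`** (MACKEY over `G_v = B·K₁`, FILE C `cover_borel_K1`; §1 `inducingLine_eq_one_of_mem_K1`; the witness of §2 lies in `I ≤ K₁`).  The general form of FILE D
`finrank_fixedPoints_cmPrincipalSeries_stChar_K1`. [cite: Borel1976, §3–§4] [cite: Casselman1995, Prop. 1.3.1, §3] [cite: Tits1979, §3.3.2] -/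
theorem finrank_fixedPoints_cmPrincipalSeries_K1 {ϖ : w.1.adicCompletion L}
    (hd : HermitianLattice.UnramifiedLocalConjDatum (galAdicCompletionMap (L := L) (IsCMField.complexConj L) hw) ϖ)
    (g₁ : GL (Fin 3) (w.1.adicCompletion L)) (hg₁ : (g₁ : Matrix (Fin 3) (Fin 3) (w.1.adicCompletion L)) = Matrix.diagonal ![(1 : w.1.adicCompletion L), 1, ϖ])
    (K0 K1 I : Subgroup (Gqs L v))
    (hK0 : K0 = ((glInt 3 (w.1.adicCompletion L)).subgroupOf
      (unitaryGroupOfForm (galAdicCompletionMap (L := L) (IsCMField.complexConj L) hw) ((StdForm.antidiagonal 3).over (w.1.adicCompletion L)))).comap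
        eA.toMulEquiv.toMonoidHom)
    (hK1 : K1 = (((glInt 3 (w.1.adicCompletion L)).map (MulAut.conj g₁).toMonoidHom).subgroupOf
      (unitaryGroupOfForm (galAdicCompletionMap (L := L) (IsCMField.complexConj L) hw) ((StdForm.antidiagonal 3).over (w.1.adicCompletion L)))).comap
        eA.toMulEquiv.toMonoidHom)
    (hI : I = K0 ⊓ K1)
    (χ : ↥(torusU (conjLocal L (IsCMField.complexConj L) v) (cmLocalForm L 3 v)) →* ℂˣ) :
    Module.finrank ℂ ((cmPrincipalSeries L 3 v χ).fixedPoints K1) = if (∀ t : ↥(torusU (conjLocal L (IsCMField.complexConj L) v) (cmLocalForm L 3 v)), (t : ↥(unitaryGroupOfForm (conjLocal L (IsCMField.complexConj L) v) (cmLocalForm L 3 v))) ∈ cmLocalIntegralLevel L 3 (qsForm L) v → χ t = 1) then 1 else 0 := by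
  haveI := locallyCompactSpace_cmBorelU L 3 v
  have hK1o' := (isOpen_isCompact_levels L v w hw eA g₁ K0 K1 I hK0 hK1 hI).2.1.1
  have hK1o : @IsOpen ↥(unitaryGroupOfForm (conjLocal L (IsCMField.complexConj L) v) (cmLocalForm L 3 v)) inferInstance (K1 : Set (Gqs L v)) := hK1o'
  have hdisj : ∀ i j : Unit, (∃ h : ↥(cmBorelTriple L 3 v).P, ∃ κ : ↥(unitaryGroupOfForm (conjLocal L (IsCMField.complexConj L) v) (cmLocalForm L 3 v)), κ ∈ K1 ∧
      (fun _ : Unit => (1 : ↥(unitaryGroupOfForm (conjLocal L (IsCMField.complexConj L) v) (cmLocalForm L 3 v)))) j = (h : ↥(unitaryGroupOfForm (conjLocal L (IsCMField.complexConj L) v) (cmLocalForm L 3 v))) * (fun _ : Unit => (1 : ↥(unitaryGroupOfForm (conjLocal L (IsCMField.complexConj L) v) (cmLocalForm L 3 v)))) i * κ) → i = j := fun _ _ _ => Subsingleton.elim _ _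
  have hM := Representation.finrank_fixedPoints_smoothIndRep_eq_card_filter (Representation.twist
      (((Representation.trivial ℂ ↥(torusU (conjLocal L (IsCMField.complexConj L) v) (cmLocalForm L 3 v)) ℂ).twist χ).comp (cmBorelTriple L 3 v).proj)
      (rootDeltaChar (cmBorelTriple L 3 v).P)) hK1o
    (cover_borel_K1 L v w hw eA heA hd g₁ hg₁ K1 hK1) hdisj (Module.finrank_self ℂ)
  refine hM.trans ?_
  by_cases hU : (∀ t : ↥(torusU (conjLocal L (IsCMField.complexConj L) v) (cmLocalForm L 3 v)), (t : ↥(unitaryGroupOfForm (conjLocal L (IsCMField.complexConj L) v) (cmLocalForm L 3 v))) ∈ cmLocalIntegralLevel L 3 (qsForm L) v → χ t = 1)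
  · rw [if_pos hU, Finset.filter_true_of_mem, Finset.card_univ, Fintype.card_unit]
    intro i _ h hmem
    have hmem' : (1 : ↥(unitaryGroupOfForm (conjLocal L (IsCMField.complexConj L) v) (cmLocalForm L 3 v)))⁻¹ * (h : ↥(unitaryGroupOfForm (conjLocal L (IsCMField.complexConj L) v) (cmLocalForm L 3 v))) * 1 ∈ K1 := hmem
    rw [inv_one, one_mul, mul_one] at hmem'
    exact inducingLine_eq_one_of_mem_K1 L v w hw eA heA hd g₁ hg₁ K0 K1 I hK0 hK1 hI χ hU h hmem'
  · rw [if_neg hU, Finset.card_eq_zero, Finset.filter_eq_empty_iff]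
    push Not at hU
    obtain ⟨t, ht, hχt⟩ := hU
    obtain ⟨-, hcells⟩ := torus_mem_cells L v w hw eA heA hd g₁ hg₁ K0 K1 I hK0 hK1 hI t ht
    intro i _ hall
    have htB : ((t : ↥(unitaryGroupOfForm (conjLocal L (IsCMField.complexConj L) v) (cmLocalForm L 3 v))) ∈ (cmBorelTriple L 3 v).P) := torusU_le_borelU _ _ t.2
    have hconj : (1 : ↥(unitaryGroupOfForm (conjLocal L (IsCMField.complexConj L) v) (cmLocalForm L 3 v)))⁻¹ * (t : ↥(unitaryGroupOfForm (conjLocal L (IsCMField.complexConj L) v) (cmLocalForm L 3 v))) * 1 ∈ K1 := by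
      rw [inv_one, one_mul, mul_one]
      have h0 := hcells 0
      have heq : (![(1 : ↥(unitaryGroupOfForm (conjLocal L (IsCMField.complexConj L) v) (cmLocalForm L 3 v))), eA.symm (weylLongU (galAdicCompletionMap (L := L) (IsCMField.complexConj L) hw) (rfl : (StdForm.antidiagonal 3).over (w.1.adicCompletion L) = _))] (0 : Fin 2))⁻¹ * (t : ↥(unitaryGroupOfForm (conjLocal L (IsCMField.complexConj L) v) (cmLocalForm L 3 v))) * (![(1 : ↥(unitaryGroupOfForm (conjLocal L (IsCMField.complexConj L) v) (cmLocalForm L 3 v))), eA.symm (weylLongU (galAdicCompletionMap (L := L) (IsCMField.complexConj L) hw) (rfl : (StdForm.antidiagonal 3).over (w.1.adicCompletion L) = _))] (0 : Fin 2)) = t := by simp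
      rw [heq] at h0
      exact I_le_K1 L v K0 K1 I hI h0
    have h1p := hall ⟨_, htB⟩ hconj
    rw [inducingLine_apply_torus L v χ t ht] at h1p
    have h11 := LinearMap.congr_fun h1p (1 : ℂ)
    rw [LinearMap.smul_apply, Module.End.one_apply, smul_eq_mul, mul_one] at h11
    exact hχt (Units.val_eq_one.1 h11)

end Summit.HodgeConjecture.HodgeConjecture.Cruxes.H413.F0P3cStCharTSPSLevels

end
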